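import Summits.QuantumFields.BalabanUV.Beta.D1BFx.GhostWardWord
import Summits.QuantumFields.BalabanUV.Beta.D1BFx.MinimiserColumnGradient
import Summits.QuantumFields.BalabanUV.Beta.D1BFx.CoframeVertices
import Summits.QuantumFields.BalabanUV.Beta.D1BFx.ReducedKernelSandwichBlock
import Summits.QuantumFields.BalabanUV.Beta.D1BFx.ProfileWordCount

/-!
# `BalabanUV.Beta.D1BFx.GhostVertexDensities` — road «BF-x» for binder row D1, slot (K), GHOST-N8-SPEC v0.2 §3″ FILE F4 «VERTEX DENSITIES»:
# **THE ROAD's GHOST COLUMN WEIGHTS `c·wH κ μ (· − n•y)` AS `supNorm`-DENSITIES (value `≲ |c|·n⁻⁵`, backward difference `≲ |c|·n⁻⁶`), AND THE GHOST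
# PAIR TABLE `c•tableRedF n (diag gh₂)` AS A RANGE-1 TWO-CENTRE TABLE (`≲ |c|·n⁻¹⁰`)** — the weight letters FILE F1's majorant and FILE F2's tadpole letter ask for

HONEST DEPENDENCY (cell records, verbatim): «continuum YM on T⁴ ⇐ BetaPertH ∧ nine spine estimates (0/9 proved); BetaPertH ⇐ (D1) ∧ (D4) ∧
CAP+tail; G-an2-4 gates asym, D1 and NE2/3/4.»  HONEST FRAMING (cell contract, verbatim): «discharging `BetaPertH` makes Bałaban's UV stability
UNCONDITIONAL — a real constructive-QFT result; it is NOT the continuum limit and NOT the Clay problem.»  THIS MODULE DISCHARGES NOTHING of the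
wall: [folklore] `ℓ¹`∕`ℓ∞` repackaging BY NAME of leaf-04 g21's `GhostWardWord.abs_colH_K₀_road_le_l1` ∕ `colH_K₀_eq_wH` (the straight column's
envelope, `≲ n⁻⁵`), leaf-01 g29's L-h `MinimiserColumnGradient.abs_colH_KInvStep_zero_diff_road_le` (its fine gradient, `≲ n⁻⁶`), gan24-leaf-05's
`CoframeVertices.d2W_apply` and leaf-03's `ReducedKernelSandwichBlock.tableRedF_diagExt_apply` (the diagonal pair table in closed form).  No definition,
no `def … : Prop`, nothing cited, 0 sorry.  0 root-level binders of row D1 discharged (hW ∕ hR-sockets ∕ hSX-socket ∕ D1Tel ∕ D1Rep = 0); (K) NOT closed;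
NOT D1, NOT `BetaPertH`, NOT continuum, NOT Clay.

ABSOLUTE RULE (cell charter, verbatim): «No internally-minted statement may enter as a cited fact. Every hypothesis is either kernel-proved in
this package or a verbatim quotation of a PUBLISHED theorem with page reference. The manuscript(s) under audit are NOT citable for their own
disputed steps — they are the thing under adjudication; programme-internal (2001/route/tribunal) claims are never citable.»

WHY (GHOST-N8-SPEC v0.2 §3″ (O3)∕(O6)∕(O8); journal N-1 [D1LEAF04-G26-N1], INTENT-3).  FILE F1 (`GhostVertexOrientation.abs_comp_gW_le`) prices `comp L (gW w)`
for the road's ghost vertex `n²•vertexRedF n ghCur μ y = gW (κ u ↦ n²·wH κ μ (u − n•y))` from two WEIGHT letters in `PoissonInterior.supNorm` form: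
`|w κ z| ≤ A·e^{−(σ∕n)‖z − n•y‖∞}` and `|w κ z − w κ (z − e_κ)| ≤ A′·e^{−(σ∕n)‖z − n•y‖∞}`; FILE F2 (`OrientedProfileWords.abs_tadpole_le_of_sup_range`) prices the two
`P`-tadpoles from a RANGE-`r` table with a two-centre density on its second variable.  This file supplies exactly those letters for the road's objects
(§1–§2: `A = |c|·K₅·n⁻⁵`, `A′ = |c|·K₆·e^{κ₄∕16}·n⁻⁶`, `σ = κ₄∕16`, `κ₄ = kappa163 4`; §3: range `1`, `A₂ = |c|·8·K₅²·e^{κ₄∕8}·n⁻¹⁰`), so that F5's rows read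
`A ≍ n⁻³`, `A′ ≍ n⁻⁴`, `A₂ ≍ n⁻⁸` at `c = n²`.

CONTENT ([folklore]; `n = m + 1`; `K₅ := MG163 4·periodConst (kappa163 4) 3·e^{κ₄∕4}`, `K₆ := MD163 4·periodConst (kappa163 4) 3·e^{κ₄∕4}` written out).
* §0 `cast_supNorm_le_l1` (`‖z‖∞ ≤ |z|₁`), `exp_l1_le_exp_supNorm`, `road_rate_eq` (`κ₄∕4∕(4n) = (κ₄∕16)∕n`).
* §1 **`abs_ghostWeight_le`**: `|c·wH κ μ (z − n•y)| ≤ |c|·(n⁵)⁻¹·K₅·e^{−((κ₄∕16)∕n)‖z − n•y‖∞}`.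
* §2 **`abs_ghostWeight_sub_le`**: `|c·wH κ μ (z − n•y) − c·wH κ μ (z − e_κ − n•y)| ≤ |c|·(n⁶)⁻¹·K₆·e^{κ₄∕16}·e^{−((κ₄∕16)∕n)‖z − n•y‖∞}`.
* §3 `diag_gh₂_eq_diagExt`, **`smul_tableRedF_diag_gh₂_apply`** (`= c·d2W (wH_y) (wH_y′)`), **`abs_ghostTable_le`** (two-centre density on the second variable,
  `A₂ = |c|·8·((n⁵)⁻¹K₅)²·e^{κ₄∕8}`), **`ghostTable_eq_zero_of_far`** (range `1`).
NOT HERE (honest): the leg letters (F3), the word letter (F2), the rows (F5); anything at the END's weights.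
Unit `b2b-balaban-beta-d1-formalise-leaf-04` (gen 26), D1 formalisation swarm, road «BF-x»; INTENT-3 [D1LEAF04-G26-INTENT-3]. Not in print; no existing file touched.
-/

noncomputable section

namespace Summit.QuantumFields.BalabanUV.Beta.D1BFx.GhostVertexDensities

open scoped BigOperators
open Finset
open Literature.MathematicalPhysics.QuantumFieldTheory.Balaban1983to89
open Literature.MathematicalPhysics.QuantumFieldTheory.Balaban1983to89.Beta
open B12Sec2to5 (l1 l1_nonneg)
open ExpKernelCalculus (Site MKer l1_sub_triangle)
open AffineAveraging (unitVec)
open OneStepResolventKernel (wsum)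
open OneStepKernelFamily (KInvStep colH)
open KernelSpecInstance (wH)
open B4TorusKernel (periodConst)
open B5Hk163Strip (kappa163 kappa163_pos)
open B5Hk163TorusHolderDecay (MD163)
open B5Hk163Decay (MG163)
open PoissonInterior (supNorm nrm supNorm_neg supNorm_add_le exists_natAbs_eq_supNorm natAbs_le_supNorm)
open Summit.QuantumFields.BalabanUV.Beta.D1BFx.GhostStencil (ghCur l1_unitVec)
open Summit.QuantumFields.BalabanUV.Beta.D1BFx.TorusGhostPairStencils (gh₂ gh₂_apply)
open Summit.QuantumFields.BalabanUV.Beta.D1BFx.PackedCoframeSiteWords (d2W)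
open Summit.QuantumFields.BalabanUV.Beta.D1BFx.CoframeVertices (d2W_apply)
open Summit.QuantumFields.BalabanUV.Beta.D1BFx.ReducedTableF (tableRedF)
open Summit.QuantumFields.BalabanUV.Beta.D1BFx.ReducedKernelSandwichBlock (diagExt tableRedF_diagExt_apply)
open Summit.QuantumFields.BalabanUV.Beta.D1BFx.GhostWardWord (abs_colH_K₀_road_le_l1 colH_K₀_eq_wH)
open Summit.QuantumFields.BalabanUV.Beta.D1BFx.MinimiserColumnGradient (abs_colH_KInvStep_zero_diff_road_le)

/-! ## §0 Norm tools -/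

/-- [folklore] `‖z‖∞ ≤ |z|₁` (the `ℕ`-valued sup norm of `PoissonInterior` against the real `ℓ¹` norm of `B12Sec2to5`). -/
theorem cast_supNorm_le_l1 (z : Site 4) : (supNorm z : ℝ) ≤ l1 z := by
  obtain ⟨i, hi⟩ := exists_natAbs_eq_supNorm (by norm_num : 0 < 4) z
  rw [← hi]
  unfold B12Sec2to5.l1
  have h1 : (((z i).natAbs : ℕ) : ℝ) = |((z i : ℤ) : ℝ)| := by
    rw [← Int.cast_abs, Int.abs_eq_natAbs, Int.cast_natCast]
  rw [h1]
  exact Finset.single_le_sum (f := fun j => |((z j : ℤ) : ℝ)|) (fun j _ => abs_nonneg _) (Finset.mem_univ i)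

/-- [folklore] Hence `e^{−c|z|₁} ≤ e^{−c‖z‖∞}` for `0 ≤ c`. -/
theorem exp_l1_le_exp_supNorm {c : ℝ} (hc : 0 ≤ c) (z : Site 4) : Real.exp (-c * l1 z) ≤ Real.exp (-c * supNorm z) := by
  apply Real.exp_le_exp.mpr
  have := cast_supNorm_le_l1 z
  nlinarith

/-- [folklore] The road's rate: `κ₄∕4∕(4n) = (κ₄∕16)∕n`. -/
theorem road_rate_eq (m : ℕ) : kappa163 4 / 4 / (4 * ((m + 1 : ℕ) : ℝ)) = kappa163 4 / 16 / ((m + 1 : ℕ) : ℝ) := by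
  field_simp; ring

/-- [folklore] One lattice step costs `e^{c}` on an `ℓ¹`-damping (`0 ≤ c`): `e^{−c|z − e_κ − C|₁} ≤ e^{c}·e^{−c|z − C|₁}`. -/
theorem exp_l1_step_le {c : ℝ} (hc : 0 ≤ c) (z C : Site 4) (κ : Fin 4) :
    Real.exp (-c * l1 (z - unitVec κ - C)) ≤ Real.exp c * Real.exp (-c * l1 (z - C)) := by
  rw [← Real.exp_add]
  apply Real.exp_le_exp.mpr
  have h := l1_sub_triangle (z - C) (z - unitVec κ - C) (0 : Site 4)
  rw [sub_zero, sub_zero, show z - C - (z - unitVec κ - C) = unitVec κ by abel, l1_unitVec] at h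
  nlinarith

/-! ## §1 The column weight as a `supNorm`-density: `≲ |c|·n⁻⁵` -/

/-- [folklore] **THE GHOST COLUMN WEIGHT IS A DENSITY**: for every `c`, `κ`, `z`,
`|c·wH κ μ (z − n•y)| ≤ |c|·((n⁵)⁻¹·(MG163 4·periodConst (kappa163 4) 3)·e^{κ₄∕4})·e^{−((κ₄∕16)∕n)·‖z − n•y‖∞}` (`GhostWardWord.abs_colH_K₀_road_le_l1` +
`colH_K₀_eq_wH`, then `|·|₁ ≥ ‖·‖∞`). -/
theorem abs_ghostWeight_le (m : ℕ) (c : ℝ) (μ : Fin 4) (y : Site 4) (κ : Fin 4) (z : Site 4) :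
    |c * wH (N := m + 1) (d := 3) κ μ (z - ((m + 1 : ℕ) : ℤ) • y)|
      ≤ |c| * ((((m + 1 : ℕ) : ℝ) ^ 5)⁻¹ * (MG163 4 * periodConst (kappa163 4) 3) * Real.exp (kappa163 4 / 4))
        * Real.exp (-(kappa163 4 / 16 / ((m + 1 : ℕ) : ℝ)) * supNorm (z - ((m + 1 : ℕ) : ℤ) • y)) := by
  have h := abs_colH_K₀_road_le_l1 m μ y κ z
  rw [colH_K₀_eq_wH] at h
  simp only at h
  rw [road_rate_eq] at h
  have hc0 : 0 ≤ kappa163 4 / 16 / ((m + 1 : ℕ) : ℝ) := by have := kappa163_pos 4; positivity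
  have hK : 0 ≤ (((m + 1 : ℕ) : ℝ) ^ 5)⁻¹ * (MG163 4 * periodConst (kappa163 4) 3) * Real.exp (kappa163 4 / 4) :=
    (mul_nonneg_iff_of_pos_right (Real.exp_pos _)).1 ((abs_nonneg _).trans h)
  rw [abs_mul, mul_assoc]
  refine mul_le_mul_of_nonneg_left (h.trans (mul_le_mul_of_nonneg_left (exp_l1_le_exp_supNorm hc0 _) hK)) (abs_nonneg c)

/-! ## §2 Its backward difference along the bond: `≲ |c|·n⁻⁶` -/

/-- [folklore] **THE BACKWARD DIFFERENCE OF THE GHOST COLUMN WEIGHT IS A SMALLER DENSITY** (L-h at `u = z − e_κ`, direction `κ`; the shifted centre costs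
`e^{κ₄∕16}`): `|c·wH κ μ (z − n•y) − c·wH κ μ (z − e_κ − n•y)| ≤ |c|·((n⁶)⁻¹·(MD163 4·periodConst (kappa163 4) 3·e^{κ₄∕4})·e^{κ₄∕16})·e^{−((κ₄∕16)∕n)·‖z − n•y‖∞}`. -/
theorem abs_ghostWeight_sub_le (m : ℕ) (c : ℝ) (μ : Fin 4) (y : Site 4) (κ : Fin 4) (z : Site 4) :
    |c * wH (N := m + 1) (d := 3) κ μ (z - ((m + 1 : ℕ) : ℤ) • y) - c * wH (N := m + 1) (d := 3) κ μ (z - unitVec κ - ((m + 1 : ℕ) : ℤ) • y)|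
      ≤ |c| * ((((m + 1 : ℕ) : ℝ) ^ 6)⁻¹ * ((MD163 4 * periodConst (kappa163 4) 3) * Real.exp (kappa163 4 / 4)) * Real.exp (kappa163 4 / 16))
        * Real.exp (-(kappa163 4 / 16 / ((m + 1 : ℕ) : ℝ)) * supNorm (z - ((m + 1 : ℕ) : ℤ) • y)) := by
  have h := abs_colH_KInvStep_zero_diff_road_le m μ y κ κ (z - unitVec κ)
  rw [colH_K₀_eq_wH] at h
  simp only [sub_add_cancel] at h
  rw [road_rate_eq] at h
  set cr : ℝ := kappa163 4 / 16 / ((m + 1 : ℕ) : ℝ) with hcr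
  have hcr0 : 0 ≤ cr := by have := kappa163_pos 4; rw [hcr]; positivity
  have hcr1 : cr ≤ kappa163 4 / 16 := by
    rw [hcr]; exact div_le_self (by have := kappa163_pos 4; positivity) (by exact_mod_cast Nat.le_add_left 1 m)
  have hK : 0 ≤ (((m + 1 : ℕ) : ℝ) ^ 6)⁻¹ * ((MD163 4 * periodConst (kappa163 4) 3) * Real.exp (kappa163 4 / 4)) :=
    (mul_nonneg_iff_of_pos_right (Real.exp_pos _)).1 ((abs_nonneg _).trans h)
  -- shift the centre from `z − e_κ` to `z`, then `ℓ¹ → ℓ∞`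
  have hstep : Real.exp (-cr * l1 (z - unitVec κ - ((m + 1 : ℕ) : ℤ) • y))
      ≤ Real.exp (kappa163 4 / 16) * Real.exp (-cr * supNorm (z - ((m + 1 : ℕ) : ℤ) • y)) := by
    refine (exp_l1_step_le hcr0 z _ κ).trans ?_
    exact mul_le_mul (Real.exp_le_exp.2 hcr1) (exp_l1_le_exp_supNorm hcr0 _) (Real.exp_pos _).le (Real.exp_pos _).le
  rw [← mul_sub, abs_mul]
  calc |c| * |wH (N := m + 1) (d := 3) κ μ (z - ((m + 1 : ℕ) : ℤ) • y) - wH (N := m + 1) (d := 3) κ μ (z - unitVec κ - ((m + 1 : ℕ) : ℤ) • y)|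
      ≤ |c| * ((((m + 1 : ℕ) : ℝ) ^ 6)⁻¹ * ((MD163 4 * periodConst (kappa163 4) 3) * Real.exp (kappa163 4 / 4))
          * Real.exp (-cr * l1 (z - unitVec κ - ((m + 1 : ℕ) : ℤ) • y))) := mul_le_mul_of_nonneg_left h (abs_nonneg c)
    _ ≤ |c| * ((((m + 1 : ℕ) : ℝ) ^ 6)⁻¹ * ((MD163 4 * periodConst (kappa163 4) 3) * Real.exp (kappa163 4 / 4))
          * (Real.exp (kappa163 4 / 16) * Real.exp (-cr * supNorm (z - ((m + 1 : ℕ) : ℤ) • y)))) :=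
        mul_le_mul_of_nonneg_left (mul_le_mul_of_nonneg_left hstep hK) (abs_nonneg c)
    _ = _ := by ring

/-! ## §3 The ghost pair table: range `1`, two-centre density `≲ |c|·n⁻¹⁰` -/

/-- [our object] The row file's diagonal ghost pair family IS leaf-03's `diagExt gh₂` (the conjuncts of the guard commute). -/
theorem diag_gh₂_eq_diagExt :
    (fun (κ : Fin 4) (u : Site 4) (l : Fin 4) (u' : Site 4) => if u = u' ∧ κ = l then gh₂ κ u else (0 : MKer 4 Unit)) = diagExt (fun κ u => gh₂ κ u) := by
  funext κ u l u'
  unfold ReducedKernelSandwichBlock.diagExt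
  simp only [and_comm]

/-- [folklore] **THE ROAD's GHOST PAIR TABLE IN CLOSED FORM**: `(c•tableRedF n (diag gh₂) μ y ν y′) x z = c·d2W (κ u ↦ wH κ μ (u − n•y)) (κ u ↦ wH κ ν (u − n•y′)) x z`. -/
theorem smul_tableRedF_diag_gh₂_apply (n : ℕ) [NeZero n] (c : ℝ) (μ : Fin 4) (y : Site 4) (ν : Fin 4) (y' x z : Site 4) (a b : Unit) :
    (c • tableRedF n (fun κ u l u' => if u = u' ∧ κ = l then gh₂ κ u else (0 : MKer 4 Unit)) μ y ν y') x z a b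
      = c * d2W (fun κ u => wH (N := n) (d := 3) κ μ (u - (n : ℤ) • y)) (fun κ u => wH (N := n) (d := 3) κ ν (u - (n : ℤ) • y')) x z a b := by
  rw [diag_gh₂_eq_diagExt]
  show c * tableRedF n (diagExt (fun κ u => gh₂ κ u)) μ y ν y' x z a b = _
  rw [tableRedF_diagExt_apply]
  congr 1
  unfold PackedCoframeSiteWords.d2W OneStepResolventKernel.wsum
  refine Finset.sum_congr rfl fun κ _ => tsum_congr fun u => ?_
  ring

/-- [folklore] **THE GHOST PAIR TABLE IS A RANGE-1 TWO-CENTRE DENSITY** (on its SECOND variable): for every `y₀ x`,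
`|(c•tableRedF n (diag gh₂) μ y ν y′) y₀ x| ≤ |c|·8·((n⁵)⁻¹K₅)²·e^{κ₄∕8}·e^{−((κ₄∕16)∕n)‖x − n•y‖∞}·e^{−((κ₄∕16)∕n)‖x − n•y′‖∞}`. -/
theorem abs_ghostTable_le (m : ℕ) (c : ℝ) (μ : Fin 4) (y : Site 4) (ν : Fin 4) (y' y₀ x : Site 4) (a b : Unit) :
    |(c • tableRedF (m + 1) (fun κ u l u' => if u = u' ∧ κ = l then gh₂ κ u else (0 : MKer 4 Unit)) μ y ν y') y₀ x a b|
      ≤ |c| * (8 * ((((m + 1 : ℕ) : ℝ) ^ 5)⁻¹ * (MG163 4 * periodConst (kappa163 4) 3) * Real.exp (kappa163 4 / 4)) ^ 2 * Real.exp (kappa163 4 / 8))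
        * Real.exp (-(kappa163 4 / 16 / ((m + 1 : ℕ) : ℝ)) * supNorm (x - ((m + 1 : ℕ) : ℤ) • y))
        * Real.exp (-(kappa163 4 / 16 / ((m + 1 : ℕ) : ℝ)) * supNorm (x - ((m + 1 : ℕ) : ℤ) • y')) := by
  obtain rfl : a = () := Subsingleton.elim _ _
  obtain rfl : b = () := Subsingleton.elim _ _
  rw [smul_tableRedF_diag_gh₂_apply, d2W_apply, abs_mul]
  set n : ℕ := m + 1 with hn
  set K₅ : ℝ := (((n : ℕ) : ℝ) ^ 5)⁻¹ * (MG163 4 * periodConst (kappa163 4) 3) * Real.exp (kappa163 4 / 4) with hK₅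
  set cr : ℝ := kappa163 4 / 16 / ((n : ℕ) : ℝ) with hcr
  have hcr0 : 0 ≤ cr := by have := kappa163_pos 4; rw [hcr]; positivity
  have hcr1 : cr ≤ kappa163 4 / 16 := by
    rw [hcr, hn]; exact div_le_self (by have := kappa163_pos 4; positivity) (by exact_mod_cast Nat.le_add_left 1 m)
  -- the `ℓ¹`-form weight letters (value), both centres
  have hw : ∀ (ρ : Fin 4) (C : Site 4) (κ : Fin 4) (u : Site 4), |wH (N := n) (d := 3) κ ρ (u - ((n : ℕ) : ℤ) • C)| ≤ K₅ * Real.exp (-cr * l1 (u - ((n : ℕ) : ℤ) • C)) := by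
    intro ρ C κ u
    have h := abs_colH_K₀_road_le_l1 m ρ C κ u
    rw [colH_K₀_eq_wH] at h
    simp only at h
    rw [road_rate_eq] at h
    simpa only [hK₅, hcr, hn] using h
  have hK₅0 : 0 ≤ K₅ := by
    have h := hw μ y 0 0
    exact (mul_nonneg_iff_of_pos_right (Real.exp_pos _)).1 ((abs_nonneg _).trans h)
  -- products of two weights at `x`, and at `x − e_κ` shifted to `x`
  have E : ∀ C : Site 4, Real.exp (-cr * l1 (x - ((n : ℕ) : ℤ) • C)) ≤ Real.exp (-cr * supNorm (x - ((n : ℕ) : ℤ) • C)) :=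
    fun C => exp_l1_le_exp_supNorm hcr0 _
  have Estep : ∀ (C : Site 4) (κ : Fin 4), Real.exp (-cr * l1 (x - unitVec κ - ((n : ℕ) : ℤ) • C))
      ≤ Real.exp (kappa163 4 / 16) * Real.exp (-cr * supNorm (x - ((n : ℕ) : ℤ) • C)) := fun C κ =>
    (exp_l1_step_le hcr0 x _ κ).trans (mul_le_mul (Real.exp_le_exp.2 hcr1) (E C) (Real.exp_pos _).le (Real.exp_pos _).le)
  set Wy : ℝ := Real.exp (-cr * supNorm (x - ((n : ℕ) : ℤ) • y)) with hWy
  set Wy' : ℝ := Real.exp (-cr * supNorm (x - ((n : ℕ) : ℤ) • y')) with hWy'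
  have hterm : ∀ κ : Fin 4,
      |(if x = y₀ + unitVec κ then wH (N := n) (d := 3) κ μ (y₀ - ((n : ℕ) : ℤ) • y) * wH (N := n) (d := 3) κ ν (y₀ - ((n : ℕ) : ℤ) • y') else 0)
        + (if y₀ = x + unitVec κ then wH (N := n) (d := 3) κ μ (x - ((n : ℕ) : ℤ) • y) * wH (N := n) (d := 3) κ ν (x - ((n : ℕ) : ℤ) • y') else 0)|
      ≤ 2 * (K₅ ^ 2 * Real.exp (kappa163 4 / 8)) * Wy * Wy' := by
    intro κ
    have e8 : Real.exp (kappa163 4 / 8) = Real.exp (kappa163 4 / 16) * Real.exp (kappa163 4 / 16) := by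
      rw [← Real.exp_add]; ring_nf
    have h8 : 1 ≤ Real.exp (kappa163 4 / 8) := Real.one_le_exp (by have := kappa163_pos 4; positivity)
    -- first summand: nonzero only at `y₀ = x − e_κ`
    have t1 : |(if x = y₀ + unitVec κ then wH (N := n) (d := 3) κ μ (y₀ - ((n : ℕ) : ℤ) • y) * wH (N := n) (d := 3) κ ν (y₀ - ((n : ℕ) : ℤ) • y') else 0)|
        ≤ K₅ ^ 2 * Real.exp (kappa163 4 / 8) * Wy * Wy' := by
      by_cases hx : x = y₀ + unitVec κ
      · rw [if_pos hx, abs_mul]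
        have hy₀ : y₀ = x - unitVec κ := by rw [hx]; abel
        rw [hy₀]
        have h1 := (hw μ y κ (x - unitVec κ)).trans (mul_le_mul_of_nonneg_left (Estep y κ) hK₅0)
        have h2 := (hw ν y' κ (x - unitVec κ)).trans (mul_le_mul_of_nonneg_left (Estep y' κ) hK₅0)
        refine (mul_le_mul h1 h2 (abs_nonneg _) ((abs_nonneg _).trans h1)).trans (le_of_eq ?_)
        rw [e8, hWy, hWy']; ring
      · rw [if_neg hx, abs_zero]; positivity
    have t2 : |(if y₀ = x + unitVec κ then wH (N := n) (d := 3) κ μ (x - ((n : ℕ) : ℤ) • y) * wH (N := n) (d := 3) κ ν (x - ((n : ℕ) : ℤ) • y') else 0)|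
        ≤ K₅ ^ 2 * Real.exp (kappa163 4 / 8) * Wy * Wy' := by
      by_cases hx : y₀ = x + unitVec κ
      · rw [if_pos hx, abs_mul]
        have h1 := (hw μ y κ x).trans (mul_le_mul_of_nonneg_left (E y) hK₅0)
        have h2 := (hw ν y' κ x).trans (mul_le_mul_of_nonneg_left (E y') hK₅0)
        refine (mul_le_mul h1 h2 (abs_nonneg _) ((abs_nonneg _).trans h1)).trans ?_
        rw [hWy, hWy']
        have h0 : 0 ≤ K₅ * Real.exp (-cr * supNorm (x - ((n : ℕ) : ℤ) • y)) * (K₅ * Real.exp (-cr * supNorm (x - ((n : ℕ) : ℤ) • y'))) := by positivity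
        nlinarith [h0]
      · rw [if_neg hx, abs_zero]; positivity
    exact (abs_add_le _ _).trans (by linarith [t1, t2])
  rw [abs_neg]
  refine le_trans (mul_le_mul_of_nonneg_left ((Finset.abs_sum_le_sum_abs _ _).trans (Finset.sum_le_sum fun κ _ => hterm κ)) (abs_nonneg c)) (le_of_eq ?_)
  rw [Finset.sum_const, Finset.card_univ, Fintype.card_fin, nsmul_eq_mul, hWy, hWy', hK₅, hcr]
  push_cast
  ring

/-- [folklore] **THE GHOST PAIR TABLE HAS RANGE 1**: it vanishes unless `‖y₀ − x‖∞ ≤ 1`. -/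
theorem ghostTable_eq_zero_of_far (n : ℕ) [NeZero n] (c : ℝ) (μ : Fin 4) (y : Site 4) (ν : Fin 4) (y' y₀ x : Site 4) (a b : Unit)
    (h : 1 < supNorm (y₀ - x)) :
    (c • tableRedF n (fun κ u l u' => if u = u' ∧ κ = l then gh₂ κ u else (0 : MKer 4 Unit)) μ y ν y') y₀ x a b = 0 := by
  obtain rfl : a = () := Subsingleton.elim _ _
  obtain rfl : b = () := Subsingleton.elim _ _
  rw [smul_tableRedF_diag_gh₂_apply, d2W_apply]
  have hne1 : ∀ κ : Fin 4, ¬ x = y₀ + unitVec κ := by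
    intro κ hx
    have : supNorm (y₀ - x) ≤ 1 := by
      rw [hx, show y₀ - (y₀ + unitVec κ) = -(unitVec κ : Site 4) by abel, supNorm_neg]
      refine PoissonInterior.supNorm_le_iff.2 fun i => ?_
      rw [AffineAveraging.unitVec_apply]; split_ifs <;> simp
    omega
  have hne2 : ∀ κ : Fin 4, ¬ y₀ = x + unitVec κ := by
    intro κ hx
    have : supNorm (y₀ - x) ≤ 1 := by
      rw [hx, show x + unitVec κ - x = (unitVec κ : Site 4) by abel]
      refine PoissonInterior.supNorm_le_iff.2 fun i => ?_
      rw [AffineAveraging.unitVec_apply]; split_ifs <;> simp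
    omega
  simp only [hne1, hne2, if_false, add_zero, Finset.sum_const_zero, neg_zero, mul_zero]

end Summit.QuantumFields.BalabanUV.Beta.D1BFx.GhostVertexDensities

end
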